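import Mathlib
import HarnessLib
import HarnessLib.Audit
import Summits.Langlands.Statement
import Summits.Langlands.Langlands.Theses.SymmetricPowerAnchorSplit
import Summits.Langlands.Langlands.Theorems.MonodromyDichotomySymmetricPowerAnchor
import Literature.NumberTheory.Automorphic.ACCAutomorphyLiftingCrystalline
import Literature.NumberTheory.Automorphic.Sweep1SymmetricPower
import HarnessLib.Audit.Status.Attr

/-!
Route: SeedReachSplit

# Route SeedReachSplit — FC (Sym^{n−1} functoriality at a CM cohomological partner,
stmt-Langlands-28219) is, after ONE certified avatar-eliminating translation, exactly
Sym^{n−1}-functoriality in Satake clothing (SPF); SPF splits EXACTLY by the reach of the partner's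
ADMISSIBLE Sym^{n−1}-CONGRUENCE CLASS — whose edges are the hypotheses of the print
automorphy-lifting theorem ACC+ 6.1.1 — into a base-change-seeded piece (print), an
Eisenstein/theta-seeded piece (open: one named missing lifting theorem) and a seed-isolated residual

It suffices to show A ∧ B ∧ C (plus the certified frame FRAME″ = SPF → Langlands): for a CM field
K₀, n ≥ 6 with rank-IH below n, and an irreducible pinned-geometric Lie-irreducible σ₀ : Γ_{K₀} →
GL₂(ℚ̄_ℓ) with a cohomological cuspidal partner π₀ on GL₂/K₀, an L-algebraic cuspidal P on GL_n/K₀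
exists whose Satake parameters are a.e. Sym^{n−1} of the pair read off σ₀(Frob_v) — (A) when π₀'s
admissible congruence class reaches a base-change form, (B) when it reaches no base-change form but
an Eisenstein/theta form, (C) when it reaches neither.
Lean: `closes : BaseChangeSeededSymPower → ThetaSeededSymPower → SeedIsolatedSymPower →
SeedReachFrame → _root_.Langlands` (pure logic: two excluded middles; node kernel `SeedReach.closes
= hF (spf_of_pieces hA hB hC)`).

Rationale: WHY THIS LINE. FC as typed (host route SymmetricPowerAnchorSplit rev 1, the named-open-problem crux
«Sym^{n−1} π₀ automorphic for cohomological π₀ on GL₂ over a CM field, n ≥ 6»; potential automorphy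
only in print [corpus:paper:arxiv-2309.15880 p4]) carries a Galois avatar ρ₀ (a Sym^{n−1}-shadow of
σ₀) that plays no mathematical role; the node's ONE translation eliminates it (FC ⟺ SPF, `fc_of_spf`
proved outright from a typed Satake dictionary, the converse modulo the folklore antecedent AVX) and
lands on the automorphic side, where Newton–Thorne's architecture for Sym^m over ℚ/totally real
fields [corpus:paper:arxiv-1912.11261 p4–5] («automorphy of Sym^{n−1} is constant along families;
find one seed») has a CM-field shadow that IS in print: the non-polarised Fontaine–Laffaille
automorphy lifting theorem over CM fields, ACC+ Thm 6.1.1 [corpus:paper:arxiv-1812.09999 p64], whose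
hypotheses (p > n² unramified, both forms unramified above p, FL-small common regular weight, common
residual Sym^{n−1}-representation absolutely irreducible, decomposed generic, enormous on
Γ_{K₀(ζ_p)}, a scalar outside) we type VERBATIM (vocabulary of the tree fact
automorphyLifting_crystalline_weightZero) as the EDGE of a congruence graph on cohomological
cuspidal forms of GL₂/K₀. Sym^{n−1}-automorphy propagates along edges by a theorem, so the open
content of FC is SEED + REACH, and the population of σ₀'s splits by what the partner's class
reaches: a BASE-CHANGE form (A: print — Newton–Thorne 2022 Thm 1 [corpus:paper:arxiv-2212.03595 p3]
for the descended Hilbert form, forced regular and non-CM by cohomology of the base change and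
Lie-irreducibility of σ₀; Arthur–Clozel quadratic base change; ACC+ along the chain with
crystallinity/HT weights at p from [corpus:paper:arxiv-2607.11763 p5–6]), an EISENSTEIN/THETA form
(B: Newton–Thorne's theta seed and Skinner–Wiles' Eisenstein seed transplanted — Sym^{n−1} r̄|Γ_M is
a sum of characters, residually automorphic for free; the missing engine is ONE named theorem,
residually-reducible NON-POLARISED automorphy lifting over the CM field M, the GL_n cousin of live
route SkinnerWilesDefectOne and of the polarised [corpus:doi:10.1112/s0010437x20007484]), or NEITHER
(C, declared residual = REACH).
RANKED CRUXES. rank 2 `SeedIsolatedSymPower` (C, declared residual; open; instrumentable by a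
Bianchi congruence census) · rank 3 `ThetaSeededSymPower` (B; open, idea-needed with the engine
named) · rank 4 `BaseChangeSeededSymPower` (A; print modulo typing, attackable now — first rung =
chain length 0 = the host's planned rung stub_cmBaseChangeAnchor in Satake clothing) · rank 9
support `SeedReachFrame` (FRAME″, certified `frame_of_host` from the host's
RES/LS/FT/CSD/T′/FRAME′).
KILL CRITERIA. (k1) A refuter shows an ADMISSIBLE edge as typed (rev 1: with the level set S that
keeps each 6.1.1-witness unramified above the edge prime) does not transmit Sym^{n−1}-automorphy in
print (a hypothesis of ACC+ 6.1.1 missing from `AdmissibleSymCongruence` that cannot be restored by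
restating the edge) — the line survives a restatement of the edge, dies if no print edge exists;
(k2) `IsSymWeaklyAutomorphic`/`SymSatakeCompatibleAt` shown NOT to express «Sym^{n−1} π₀
automorphic» (normalisation of arithFrobPolyOfSatake vs symmPowerParams) — but `fc_of_spf` is
PROVED, so any slip can only make SPF stronger than intended, never vacuous; (k3) population B shown
EMPTY in print (no genuine cohomological form over any CM field admits an Eisenstein/theta
congruence at p > n²) — then C ≡ SPF∖A mod print and the split degenerates to COSTUME; (k4) AVX
refuted (irrelevant to `closes`, it only voids the necessity certificates).
NOT DECOMPOSED YET. C (reach for seed-isolated classes: a CM-field substitute for eigenvariety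
propagation); the engine RedALT of B is a single named theorem-to-be, not split; A's typer chain
(NT22 for AutomorphicRepData over totally real fields, quadratic base change API, ACC+
general-weight fact, AHTW local–global fact, Chebotarev/Brauer–Nesbitt identifications) is foreseen
as supports, not filed.
CHEAPEST FALSIFIER. Thirty minutes, no computation: read ACC+ Thm 6.1.1 (arXiv:1812.09999 p.64)
against the eleven conjuncts of `AdmissibleSymCongruence` and check that each printed hypothesis is
present or print-derivable (crystallinity at v | p from «π unramified above p» via AHTW 2026; HT
formula from the common infinity type T; residual automorphy from the other endpoint); a missing
non-derivable hypothesis kills A as typed (k1).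

Novelty: Searches RUN (2026-08-30; corpus fts+vec AND galaxy, labelled): `lit search --hybrid "automorphy
lifting residually reducible CM field"` → [corpus:doi:10.1112/s0010437x20007484] Allen–Newton–Thorne
2020 (POLARISED), Thorne 2015 JAMS (polarised), [corpus:doi:10.1007/s00222-021-01085-7]
Fakhruddin–Khare–Patrikis 2021 (lifting, not automorphy); `lit search "symmetric power functoriality
CM field"` → [corpus:paper:arxiv-2309.15880 p4] BCGNT (potential automorphy only),
[corpus:paper:arxiv-2312.01551] Matsumoto; `lit read arxiv:1912.11261 --grep reducible|theta` →
[corpus:paper:arxiv-1912.11261 p4–5] NT21a Thm 5 (theta seed over ℚ, via unitary groups —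
polarised); `lit read arxiv:1812.09999 p64` → ACC+ 6.1.1/6.1.2; [corpus:paper:arxiv-2607.11763 p5–6]
AHTW 2026; [corpus:paper:arxiv-2512.04641] Matsumoto 2025 (conjugate-self-dual GL₂ classicality —
irrelevant); galaxy: «residually reducible» --star pdf → [galaxy:pdf:3692044544767420] ANT 13(5)
2019 volume, [galaxy:pdf:-7214019842556969660] Wake–Wang-Erickson (Eisenstein ideal, GL₂/ℚ),
[galaxy:pdf:-4456907251306002080] Bellaïche–Pollack; «Skinner-Wiles|Skinner and Wiles» --star pdf →
0 hits; «symmetric power|symmetric powers» → noise only. Tree: `rg CongruenceGraph|ReflTransGen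
Summits/Langlands` → own-lineage root route CongruenceGraphSplit (vertices = Satake families,
anchors = residual automorphy, OPEN lifting engine Lift_w); SkinnerWilesDefectOne (GL₂ reducible
ordinary, defect one); no route types ACC+ hypotheses as edges. NEAR  [refs: 10.1112/s0010437x20007484, 10.1007/s00222-021-01085-7, 1912.11261, 1812.09999, doi:10.1112/s0010437x20007484, doi:10.1007/s00222-021-01085-7, paper:arxiv-2309.15880, paper:arxiv-2312.01551, arxiv:1912.11261, paper:arxiv-1912.11261, arxiv:1812.09999, paper:arxiv-2607.11763, paper:arxiv-2512.04641]

Barriers (technique_class: automorphy-lifting, congruences, sym-power-functoriality): - technique_class: automorphy-lifting, congruences, sym-power-functoriality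
- Literature.Barriers.Langlands.ResiduallyReducibleBarrier: A and every EDGE sit OUTSIDE it by
hypothesis (edges demand an absolutely irreducible, decomposed-generic Sym^{n−1} residual
representation with ENORMOUS image on Γ_{K₀(ζ_p)} — exactly the printed large-image hypotheses,
where ACC+ 6.1.1 is a theorem); B sits INSIDE its technique class and requires beating it: the seed
step at an Eisenstein/theta form β needs automorphy lifting for a residually REDUCIBLE (sum of
characters on Γ_M) non-polarised Sym^{n−1} r_β|Γ_M — declared IDEA-NEEDED with the missing theorem
NAMED (RedALT); the how = the printed evasions the entry itself records (Skinner–Wiles: patch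
deformation rings after a base change making the reducible locus small; Thorne 2015 /
Allen–Newton–Thorne 2020: 'Schur' ρ̄ with pairwise distinct constituents — generic for Sym^{n−1}(χ̄₁
⊕ χ̄₂) = ⊕ χ̄₁^{a}χ̄₂^{n−1−a} — plus a Steinberg auxiliary place) transplanted to the 10-author/ACC+
setting; live route SkinnerWilesDefectOne is the GL₂ defect-one test of exactly this transplant. C
is the declared residual.
- Literature.Barriers.Langlands.TaylorWilesNumericalCoincidence: A and the edges sit inside the
Taylor–Wiles/Calegari–Geraghty class but where it is a THEOREM (ACC+ 6.1.1 runs patching at defect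
l₀ > 0 over CM fields using the vanishing theorems of the 10-author paper / Caraiani–Scholze); B
additionally needs it in the reducible case (previ

History (route lifecycle, newest last):
- 2026-08-30T22:35:05Z · rev 1: restated SeedIsolatedSymPower (stmt-Langlands-26672), ThetaSeededSymPower (stmt-Langlands-26673), BaseChangeSeededSymPower (stmt-Langlands-26674) — rev 1 (lens-3-g15, self-found chain-transmission gap = KILL CRITERION k1 averted + critic x1): every ADMISSIBLE edge now carries a class-wide LEVEL SET S (both (planner-decomp-langlands-writer-1-g5-0)

sub-problem: Langlands · status: draft · opened planner-decomp-langlands-writer-1-g5-0 2026-08-30T22:03:39Z · rev 1 · ledger route-Langlands-SeedReachSplit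
GENERATED by the gate from the ledger (D-0016/17). Provers cite these decls: `theorem foo : Summit.Langlands.Langlands.Theses.SeedReachSplit.<Decl> := …` in Summits/Langlands/Langlands/Theorems/<Name>.lean.
-/

namespace Summit.Langlands.Langlands.Theses.SeedReachSplit

open scoped BigOperators Topology Manifold Classical MeasureTheory ProbabilityTheory Matrix InnerProductSpace ComplexConjugate ContinuousMap
open Filter Set Function TopologicalSpace MeasureTheory

attribute [summit_statement] _root_.Langlands

-- earlier SeedIsolatedSymPower (stmt-Langlands-26672, replaced 2026-08-30T22:35:05Z -> stmt-Langlands-26838): retired by None — ∀ (K₀ : Type) [Field K₀] [NumberField K₀] (n : ℕ) (hcpt : Literature.NumberTheory.Automorphic.isCompact_glFiniteIntegralLevel n K₀), 6 ≤ n → Summit.Langlands.Langlands.Theorems.MonodromyDichotomySymmetricPowerAnchor.RankIH n → NumberField.IsCMField K₀ → ∀ (ℓ : ℕ) [Fact ℓ.Pr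
/-- item stmt-Langlands-26838 · crux · rank 2 · open · by planner
why it might fail: Declared residual: seed-isolated genuine classes may be infinite and nothing in print propagates Sym^{n−1}-automorphy INTO them (no positive-dimensional eigenvariety continuation at l₀ ≥ 1; classical points not Zariski dense); could be as hard as FC on that population.
sources: NewtonThorne2021a = Publ. IHES 134 (2021) doi:10.1007/s10240-021-00127-3, arXiv:1912.11261, Thm 5 + the theta-series seed and level raising [corpus:paper:arxiv-1912.11261 p4-5], ACCGHLNSTT2023 = arXiv:1812.09999, Ann. of Math. 197 (2023), Thm 6.1.1 (non-polarised FL automorphy lifting over CM) [corpus:paper:arxiv-1812.09999 p64; p3]; tree fact Literature.NumberTheory.Automorphic.ACCGHLNSTT2023.automorphyLifting_crystalline_weightZero, BoxerCalegariGeeNewtonThorne2023 = arXiv:2309.15880, Thm C (Sym^m of GL_2 over CM: POTENTIAL automorphy only; p4 «actually modular seems out of reach») [corpus:paper:arxiv-2309.15880 p4], paper:arxiv-2212.03591 (a p-adic approach to level-raising congruences; instrument pointer for the size of congruence classes) [corpus:paper:arxiv-2212.03591 p1], tree: Summit.Langlands.Langlands.Theses.CongruenceGraphSplit (own lineage g3: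 residual-automorphy congruence graph at the ROOT, open lifting engine — the delta is stated in NOVELTY), tree: Summit.Langlands.Langlands.Theses.SymmetricPowerAnchorSplit (rev 1) — CMSymmetricPowerAutomorphy stmt-Langlands-28219, closes; Theorems.MonodromyDichotomySymmetricPowerAnchor (cm_iff, cm_of_langlands, IsPinnedGeometric, IsLieIrreducible, RankIH, IsSymShadow, HasCohomologicalPartner)
[crux] C — SEED-ISOLATED Sym^{n−1} (DECLARED RESIDUAL; WEAKER than SPF/FC: kernel `c_of_spf`,
`c_of_fc` mod AVX; Langlands-implied `c_of_langlands` mod AVX). K₀ CM, n ≥ 6, rank-IH below n; σ₀ :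
Γ_{K₀} → GL₂(ℚ̄_ℓ) irreducible, pinned-geometric, Lie-irreducible, with a cohomological cuspidal
partner; IF the partner's admissible Sym^{n−1}-congruence class (ReflTransGen of
AdmissibleSymCongruence = ACC+ 6.1.1 hypotheses at a common level set S) reaches, for NO level set,
a base-change form or an Eisenstein/theta form, THEN σ₀ is Sym^{n−1}-weakly automorphic (an
L-algebraic cuspidal P on GL_n/K₀ with Satake parameters a.e. symmPowerParams (n−1) of the pair read
off σ₀(Frob_v)). = REACH: the honest open residue «seed-isolated genuine classes»; heuristically
sparse (level raising makes classes large) but no theorem; IDEA-NEEDED (a CM substitute for NT21a's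
eigenvariety propagation) · INSTRUMENTABLE (test I-C: congruence graph of genuine weight-2 Bianchi
newforms, LMFDB). -/
@[route_item "route-Langlands-SeedReachSplit", crux]
def SeedIsolatedSymPower : Prop :=
  ∀ (K₀ : Type) [Field K₀] [NumberField K₀] (n : ℕ) (hcpt : Literature.NumberTheory.Automorphic.isCompact_glFiniteIntegralLevel n K₀), 6 ≤ n → Summit.Langlands.Langlands.Theorems.MonodromyDichotomySymmetricPowerAnchor.RankIH n → NumberField.IsCMField K₀ → ∀ (ℓ : ℕ) [Fact ℓ.Prime] (ι : PadicAlgCl ℓ ≃+* ℂ) (σ₀ : Literature.NumberTheory.GaloisRepresentations.FramedGaloisRep K₀ (PadicAlgCl ℓ) 2), σ₀.toGaloisRep.IsIrreducible → Summit.Langlands.Langlands.Theorems.MonodromyDichotomySymmetricPowerAnchor.IsPinnedGeometric K₀ ℓ σ₀ → Summit.Langlands.Langlands.Theorems.MonodromyDichotomySymmetricPowerAnchor.IsLieIrreducible K₀ ℓ σ₀ → Summit.Langlands.Langlands.Theorems.MonodromyDichotomySymmetricPowerAnchor.HasCohomologicalPartner K₀ ℓ ι σ₀ → ¬ (∃ (hcpt₂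 : Literature.NumberTheory.Automorphic.isCompact_glFiniteIntegralLevel 2 K₀) (S : Finset (IsDedekindDomain.HeightOneSpectrum (NumberField.RingOfIntegers K₀))) (π₀ β : Literature.NumberTheory.Automorphic.CuspidalAutomorphicRepData 2 K₀ hcpt₂), (∀ᶠ v : IsDedekindDomain.HeightOneSpectrum (NumberField.RingOfIntegers K₀) in Filter.cofinite, SatakeFrobCompatibleAt ι π₀.1 σ₀ v) ∧ Relation.ReflTransGen (fun π π' : Literature.NumberTheory.Automorphic.CuspidalAutomorphicRepData 2 K₀ hcpt₂ => (∀ v : IsDedekindDomain.HeightOneSpectrum (NumberField.RingOfIntegers K₀), v ∉ S → π.1.IsUnramifiedAt v ∧ π'.1.IsUnramifiedAt v) ∧ ∃ (p : ℕ) (_ : Fact p.Prime) (ι' : PadicAlgCl p ≃+* ℂ) (T : Literature.NumberTheory.Automorphic.InfinityType K₀ 2) (s s' : Literature.NumberTheory.GaloisRepresentations.FramedGaloisRep K₀ (PadicAlgCl p) 2) (R R' : Literature.NumberTheory.GaloisRepresentations.FramedGaloisRep K₀ (PadicAlgCl p) n) (τ : Field.absoluteGaloisGroup K₀ →* Matrix.GeneralLinearGroup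 (Fin n) (Literature.NumberTheory.GaloisRepresentations.padicAlgClResidueField p)), n ^ 2 < p ∧ Algebra.IsUnramifiedIn (NumberField.RingOfIntegers K₀) (Ideal.span {(p : ℤ)}) ∧ (∀ v : IsDedekindDomain.HeightOneSpectrum (NumberField.RingOfIntegers K₀), ((p : ℕ) : NumberField.RingOfIntegers K₀) ∈ v.asIdeal → v ∉ S) ∧ (∀ v : IsDedekindDomain.HeightOneSpectrum (NumberField.RingOfIntegers K₀), ((p : ℕ) : NumberField.RingOfIntegers K₀) ∈ v.asIdeal → π.1.IsUnramifiedAt v ∧ π'.1.IsUnramifiedAt v) ∧ π.1.HasInfinityType T ∧ π'.1.HasInfinityType T ∧ T.IsLAlgebraic ∧ T.IsRegular ∧ (∀ e : K₀ →+* ℂ, ∀ w₁ ∈ T e, ∀ w₂ ∈ T e, ((n : ℝ) - 1) * (‖w₁.a - w₂.a‖ + ‖w₁.b - w₂.b‖ + 2) + 2 * n < (p : ℝ)) ∧ (∀ᶠ v : IsDedekindDomain.HeightOneSpectrum (NumberField.RingOfIntegers K₀) in Filter.cofinite, SatakeFrobCompatibleAt ι' π.1 s v) ∧ (∀ᶠ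 v : IsDedekindDomain.HeightOneSpectrum (NumberField.RingOfIntegers K₀) in Filter.cofinite, SatakeFrobCompatibleAt ι' π'.1 s' v) ∧ Summit.Langlands.Langlands.Theorems.MonodromyDichotomySymmetricPowerAnchor.IsSymShadow K₀ p n R s ∧ Summit.Langlands.Langlands.Theorems.MonodromyDichotomySymmetricPowerAnchor.IsSymShadow K₀ p n R' s' ∧ R.IsResidualRepOf (RingHom.id _) τ ∧ R'.IsResidualRepOf (RingHom.id _) τ ∧ Literature.NumberTheory.GaloisRepresentations.IsAbsIrreducible τ ∧ Literature.NumberTheory.GaloisRepresentations.IsDecomposedGeneric τ ∧ Literature.NumberTheory.GaloisRepresentations.IsAbsIrreducible (τ.comp (Literature.NumberTheory.GaloisRepresentations.absGaloisGroupAdjoinRootsOfUnity K₀ p).subtype) ∧ Literature.NumberTheory.GaloisRepresentations.Subgroup.IsEnormous ((Literature.NumberTheory.GaloisRepresentations.absGaloisGroupAdjoinRootsOfUnity K₀ p).map τ) ∧ ∃ g₀ : Field.absoluteGaloisGroup K₀, g₀ ∉ Literature.NumberTheory.GaloisRepresentations.absGaloisGroupAdjoinRootsOfUnity K₀ p ∧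 ∃ c : Literature.NumberTheory.GaloisRepresentations.padicAlgClResidueField p, ((τ g₀ : Matrix.GeneralLinearGroup (Fin n) (Literature.NumberTheory.GaloisRepresentations.padicAlgClResidueField p)) : Matrix (Fin n) (Fin n) (Literature.NumberTheory.GaloisRepresentations.padicAlgClResidueField p)) = c • (1 : Matrix (Fin n) (Fin n) (Literature.NumberTheory.GaloisRepresentations.padicAlgClResidueField p))) π₀ β ∧ ∃ (p : ℕ) (_ : Fact p.Prime) (ι' : PadicAlgCl p ≃+* ℂ) (s : Literature.NumberTheory.GaloisRepresentations.FramedGaloisRep K₀ (PadicAlgCl p) 2), (∀ᶠ v : IsDedekindDomain.HeightOneSpectrum (NumberField.RingOfIntegers K₀) in Filter.cofinite, SatakeFrobCompatibleAt ι' β.1 s v) ∧ ∃ (F : Type) (_ : Field F) (_ : NumberField F) (_ : Algebra F K₀), NumberField.IsTotallyReal F ∧ Module.finrank F K₀ = 2 ∧ ∃ (sF : Literature.NumberTheory.GaloisRepresentations.FramedGaloisRep F (PadicAlgCl p) 2) (χ : Field.absoluteGaloisGroup K₀ →* PadicAlgCl p), sF.toGaloisRep.IsIrreducible ∧ Summit.Langlands.Langlands.Theorems.MonodromyDichotomySymmetricPowerAnchor.IsPinnedGeometric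 F p sF ∧ ∀ g : Field.absoluteGaloisGroup K₀, Literature.NumberTheory.GaloisRepresentations.FramedRep.charpoly s g = (Literature.NumberTheory.GaloisRepresentations.FramedRep.charpoly (sF.restrictField K₀) g).scaleRoots (χ g)) → ¬ (∃ (hcpt₂ : Literature.NumberTheory.Automorphic.isCompact_glFiniteIntegralLevel 2 K₀) (S : Finset (IsDedekindDomain.HeightOneSpectrum (NumberField.RingOfIntegers K₀))) (π₀ β : Literature.NumberTheory.Automorphic.CuspidalAutomorphicRepData 2 K₀ hcpt₂), (∀ᶠ v : IsDedekindDomain.HeightOneSpectrum (NumberField.RingOfIntegers K₀) in Filter.cofinite, SatakeFrobCompatibleAt ι π₀.1 σ₀ v) ∧ Relation.ReflTransGen (fun π π' : Literature.NumberTheory.Automorphic.CuspidalAutomorphicRepData 2 K₀ hcpt₂ => (∀ v : IsDedekindDomain.HeightOneSpectrum (NumberField.RingOfIntegers K₀), v ∉ S → π.1.IsUnramifiedAt v ∧ π'.1.IsUnramifiedAt v) ∧ ∃ (p : ℕ) (_ : Fact p.Prime) (ι' : PadicAlgCl p ≃+* ℂ) (T : Literature.NumberTheory.Automorphic.InfinityType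 K₀ 2) (s s' : Literature.NumberTheory.GaloisRepresentations.FramedGaloisRep K₀ (PadicAlgCl p) 2) (R R' : Literature.NumberTheory.GaloisRepresentations.FramedGaloisRep K₀ (PadicAlgCl p) n) (τ : Field.absoluteGaloisGroup K₀ →* Matrix.GeneralLinearGroup (Fin n) (Literature.NumberTheory.GaloisRepresentations.padicAlgClResidueField p)), n ^ 2 < p ∧ Algebra.IsUnramifiedIn (NumberField.RingOfIntegers K₀) (Ideal.span {(p : ℤ)}) ∧ (∀ v : IsDedekindDomain.HeightOneSpectrum (NumberField.RingOfIntegers K₀), ((p : ℕ) : NumberField.RingOfIntegers K₀) ∈ v.asIdeal → v ∉ S) ∧ (∀ v : IsDedekindDomain.HeightOneSpectrum (NumberField.RingOfIntegers K₀), ((p : ℕ) : NumberField.RingOfIntegers K₀) ∈ v.asIdeal → π.1.IsUnramifiedAt v ∧ π'.1.IsUnramifiedAt v) ∧ π.1.HasInfinityType T ∧ π'.1.HasInfinityType T ∧ T.IsLAlgebraic ∧ T.IsRegular ∧ (∀ e : K₀ →+* ℂ, ∀ w₁ ∈ T e, ∀ w₂ ∈ T e, ((n : ℝ) - 1) * (‖w₁.a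 - w₂.a‖ + ‖w₁.b - w₂.b‖ + 2) + 2 * n < (p : ℝ)) ∧ (∀ᶠ v : IsDedekindDomain.HeightOneSpectrum (NumberField.RingOfIntegers K₀) in Filter.cofinite, SatakeFrobCompatibleAt ι' π.1 s v) ∧ (∀ᶠ v : IsDedekindDomain.HeightOneSpectrum (NumberField.RingOfIntegers K₀) in Filter.cofinite, SatakeFrobCompatibleAt ι' π'.1 s' v) ∧ Summit.Langlands.Langlands.Theorems.MonodromyDichotomySymmetricPowerAnchor.IsSymShadow K₀ p n R s ∧ Summit.Langlands.Langlands.Theorems.MonodromyDichotomySymmetricPowerAnchor.IsSymShadow K₀ p n R' s' ∧ R.IsResidualRepOf (RingHom.id _) τ ∧ R'.IsResidualRepOf (RingHom.id _) τ ∧ Literature.NumberTheory.GaloisRepresentations.IsAbsIrreducible τ ∧ Literature.NumberTheory.GaloisRepresentations.IsDecomposedGeneric τ ∧ Literature.NumberTheory.GaloisRepresentations.IsAbsIrreducible (τ.comp (Literature.NumberTheory.GaloisRepresentations.absGaloisGroupAdjoinRootsOfUnity K₀ p).subtype) ∧ Literature.NumberTheory.GaloisRepresentations.Subgroup.IsEnormous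 ((Literature.NumberTheory.GaloisRepresentations.absGaloisGroupAdjoinRootsOfUnity K₀ p).map τ) ∧ ∃ g₀ : Field.absoluteGaloisGroup K₀, g₀ ∉ Literature.NumberTheory.GaloisRepresentations.absGaloisGroupAdjoinRootsOfUnity K₀ p ∧ ∃ c : Literature.NumberTheory.GaloisRepresentations.padicAlgClResidueField p, ((τ g₀ : Matrix.GeneralLinearGroup (Fin n) (Literature.NumberTheory.GaloisRepresentations.padicAlgClResidueField p)) : Matrix (Fin n) (Fin n) (Literature.NumberTheory.GaloisRepresentations.padicAlgClResidueField p)) = c • (1 : Matrix (Fin n) (Fin n) (Literature.NumberTheory.GaloisRepresentations.padicAlgClResidueField p))) π₀ β ∧ ∃ (p : ℕ) (_ : Fact p.Prime) (ι' : PadicAlgCl p ≃+* ℂ) (s : Literature.NumberTheory.GaloisRepresentations.FramedGaloisRep K₀ (PadicAlgCl p) 2) (τ₂ : Field.absoluteGaloisGroup K₀ →* Matrix.GeneralLinearGroup (Fin 2) (Literature.NumberTheory.GaloisRepresentations.padicAlgClResidueField p)) (M : Type) (_ : Field M) (_ : NumberField M) (_ : Algebra K₀ M), n ^ 2 < p ∧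 (∀ᶠ v : IsDedekindDomain.HeightOneSpectrum (NumberField.RingOfIntegers K₀) in Filter.cofinite, SatakeFrobCompatibleAt ι' β.1 s v) ∧ s.IsResidualRepOf (RingHom.id _) τ₂ ∧ 0 < Module.finrank K₀ M ∧ Module.finrank K₀ M ≤ 2 ∧ NumberField.IsCMField M ∧ ¬ Literature.NumberTheory.GaloisRepresentations.IsAbsIrreducible (τ₂.comp (Literature.NumberTheory.GaloisRepresentations.absGaloisRestrictMonoidHom K₀ M))) → ∃ P : Literature.NumberTheory.Automorphic.CuspidalAutomorphicRepData n K₀ hcpt, P.1.IsLAlgebraic ∧ ∀ᶠ v : IsDedekindDomain.HeightOneSpectrum (NumberField.RingOfIntegers K₀) in Filter.cofinite, ∃ a b : ℂ, σ₀.IsUnramifiedAt v ∧ σ₀.HasFrobCharpolyAt v (Literature.NumberTheory.Automorphic.arithFrobPolyOfSatake ι v.residueCard 1 ({a, b} : Multiset ℂ)) ∧ P.1.HasSatakeParamAt v (Literature.NumberTheory.Automorphic.symmPowerParams (n - 1) a b)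

-- earlier ThetaSeededSymPower (stmt-Langlands-26673, replaced 2026-08-30T22:35:05Z -> stmt-Langlands-26839): retired by None — ∀ (K₀ : Type) [Field K₀] [NumberField K₀] (n : ℕ) (hcpt : Literature.NumberTheory.Automorphic.isCompact_glFiniteIntegralLevel n K₀), 6 ≤ n → Summit.Langlands.Langlands.Theorems.MonodromyDichotomySymmetricPowerAnchor.RankIH n → NumberField.IsCMField K₀ → ∀ (ℓ : ℕ) [Fact ℓ.Pri
/-- item stmt-Langlands-26839 · crux · rank 3 · open · by planner
why it might fail: Needs residually-REDUCIBLE non-polarised automorphy lifting over a CM field in rank n ≥ 6 — not in print (Allen–Newton–Thorne 2020 is polarised; Skinner–Wiles is GL₂ ordinary); reducible deformation theory at positive defect may genuinely fail (Eisenstein classes in degree > q₀).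
sources: NewtonThorne2021a = Publ. IHES 134 (2021) doi:10.1007/s10240-021-00127-3, arXiv:1912.11261, Thm 5 + the theta-series seed and level raising [corpus:paper:arxiv-1912.11261 p4-5], AllenNewtonThorne2020 = Compositio 156, doi:10.1112/s0010437x20007484 (automorphy lifting for residually reducible l-adic Galois representations II — POLARISED) [corpus:doi:10.1112/s0010437x20007484], tree: Summit.Langlands.Langlands.Theses.SkinnerWilesDefectOne (live route: residually reducible ordinary GL_2 over imaginary quadratic fields, defect one; SkinnerWiles1999 Publ. IHES 89), Berger2009 = Compositio 145 (2009) 603-632, doi:10.1112/S0010437X09003984 (Eisenstein ideal for imaginary quadratic fields: cuspidal cohomological forms congruent to Eisenstein series exist when p | L-value), ArthurClozel1989 = Ann. of Math. Stud. 120 (cyclic base change and descent; tree: Literature.NumberTheory.Automorphic.baseChange_cyclic_cuspidal, exists_baseChange_cyclic), ACCGHLNSTT2023 = arXiv:1812.09999, Ann. of Math. 197 (2023), Thm 6.1.1 (non-polarised FL automorphy lifting over CM) [corpus:paper:arxiv-1812.09999 p64; p3]; tree fact Literature.NumberTheory.Automorphic.ACCGHLNSTT2023.automorphyLifting_cryst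alline_weightZero
[crux] B — EISENSTEIN/THETA-SEEDED Sym^{n−1} (WEAKER than SPF/FC: kernel `b_of_spf`; misses
population C). Same σ₀; IF the partner's admissible class (at a common level set S, as in A) reaches
no base-change form but reaches a form β whose p-adic avatar (p > n²) is residually NOT absolutely
irreducible on Γ_M for a CM field M ⊇ K₀ with [M:K₀] ≤ 2 (Eisenstein congruence r̄ ~ χ̄₁ ⊕ χ̄₂, or
theta congruence r̄ ~ Ind_M ψ̄ — Newton–Thorne's seed NT21a Thm 5 / Skinner–Wiles' seed), THEN σ₀ is
Sym^{n−1}-weakly automorphic. OPEN; reduces modulo print (cyclic descent M/K₀, ACC+ along the chain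
as in A) to ONE named missing theorem RedALT = automorphy lifting for NON-POLARISED n-dimensional
crystalline FL representations of Γ_M (M CM, p > n²) with residually Eisenstein (sum of characters)
reduction — GL_n cousin of live route SkinnerWilesDefectOne, non-polarised cousin of
Allen–Newton–Thorne 2020; sits inside Literature.Barriers.Langlands.ResiduallyReducibleBarrier
(requires beating it; evasions recorded there: Skinner–Wiles base change + 'Schur' ρ̄ + Steinberg
place). Population non-empty: UNDECIDED, test I-B (a genuine cohomological Bianchi newform with an
Eisenstein/CM congruence at p ≥ 3 -/
@[route_item "route-Langlands-SeedReachSplit", crux]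
def ThetaSeededSymPower : Prop :=
  ∀ (K₀ : Type) [Field K₀] [NumberField K₀] (n : ℕ) (hcpt : Literature.NumberTheory.Automorphic.isCompact_glFiniteIntegralLevel n K₀), 6 ≤ n → Summit.Langlands.Langlands.Theorems.MonodromyDichotomySymmetricPowerAnchor.RankIH n → NumberField.IsCMField K₀ → ∀ (ℓ : ℕ) [Fact ℓ.Prime] (ι : PadicAlgCl ℓ ≃+* ℂ) (σ₀ : Literature.NumberTheory.GaloisRepresentations.FramedGaloisRep K₀ (PadicAlgCl ℓ) 2), σ₀.toGaloisRep.IsIrreducible → Summit.Langlands.Langlands.Theorems.MonodromyDichotomySymmetricPowerAnchor.IsPinnedGeometric K₀ ℓ σ₀ → Summit.Langlands.Langlands.Theorems.MonodromyDichotomySymmetricPowerAnchor.IsLieIrreducible K₀ ℓ σ₀ → Summit.Langlands.Langlands.Theorems.MonodromyDichotomySymmetricPowerAnchor.HasCohomologicalPartner K₀ ℓ ι σ₀ → ¬ (∃ (hcpt₂ : Literature.NumberTheory.Automorphic.isCompact_glFiniteIntegralLevel 2 K₀) (S : Finset (IsDedekindDomain.HeightOneSpectrum (NumberField.RingOfIntegers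 K₀))) (π₀ β : Literature.NumberTheory.Automorphic.CuspidalAutomorphicRepData 2 K₀ hcpt₂), (∀ᶠ v : IsDedekindDomain.HeightOneSpectrum (NumberField.RingOfIntegers K₀) in Filter.cofinite, SatakeFrobCompatibleAt ι π₀.1 σ₀ v) ∧ Relation.ReflTransGen (fun π π' : Literature.NumberTheory.Automorphic.CuspidalAutomorphicRepData 2 K₀ hcpt₂ => (∀ v : IsDedekindDomain.HeightOneSpectrum (NumberField.RingOfIntegers K₀), v ∉ S → π.1.IsUnramifiedAt v ∧ π'.1.IsUnramifiedAt v) ∧ ∃ (p : ℕ) (_ : Fact p.Prime) (ι' : PadicAlgCl p ≃+* ℂ) (T : Literature.NumberTheory.Automorphic.InfinityType K₀ 2) (s s' : Literature.NumberTheory.GaloisRepresentations.FramedGaloisRep K₀ (PadicAlgCl p) 2) (R R' : Literature.NumberTheory.GaloisRepresentations.FramedGaloisRep K₀ (PadicAlgCl p) n) (τ : Field.absoluteGaloisGroup K₀ →* Matrix.GeneralLinearGroup (Fin n) (Literature.NumberTheory.GaloisRepresentations.padicAlgClResidueField p)), n ^ 2 < p ∧ Algebra.IsUnramifiedIn (NumberField.RingOfIntegers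 K₀) (Ideal.span {(p : ℤ)}) ∧ (∀ v : IsDedekindDomain.HeightOneSpectrum (NumberField.RingOfIntegers K₀), ((p : ℕ) : NumberField.RingOfIntegers K₀) ∈ v.asIdeal → v ∉ S) ∧ (∀ v : IsDedekindDomain.HeightOneSpectrum (NumberField.RingOfIntegers K₀), ((p : ℕ) : NumberField.RingOfIntegers K₀) ∈ v.asIdeal → π.1.IsUnramifiedAt v ∧ π'.1.IsUnramifiedAt v) ∧ π.1.HasInfinityType T ∧ π'.1.HasInfinityType T ∧ T.IsLAlgebraic ∧ T.IsRegular ∧ (∀ e : K₀ →+* ℂ, ∀ w₁ ∈ T e, ∀ w₂ ∈ T e, ((n : ℝ) - 1) * (‖w₁.a - w₂.a‖ + ‖w₁.b - w₂.b‖ + 2) + 2 * n < (p : ℝ)) ∧ (∀ᶠ v : IsDedekindDomain.HeightOneSpectrum (NumberField.RingOfIntegers K₀) in Filter.cofinite, SatakeFrobCompatibleAt ι' π.1 s v) ∧ (∀ᶠ v : IsDedekindDomain.HeightOneSpectrum (NumberField.RingOfIntegers K₀) in Filter.cofinite, SatakeFrobCompatibleAt ι' π'.1 s' v) ∧ Summit.Langlands.Langlands.Theorems.MonodromyDichotomySymmetricPowerAnchor.IsSymShadow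 K₀ p n R s ∧ Summit.Langlands.Langlands.Theorems.MonodromyDichotomySymmetricPowerAnchor.IsSymShadow K₀ p n R' s' ∧ R.IsResidualRepOf (RingHom.id _) τ ∧ R'.IsResidualRepOf (RingHom.id _) τ ∧ Literature.NumberTheory.GaloisRepresentations.IsAbsIrreducible τ ∧ Literature.NumberTheory.GaloisRepresentations.IsDecomposedGeneric τ ∧ Literature.NumberTheory.GaloisRepresentations.IsAbsIrreducible (τ.comp (Literature.NumberTheory.GaloisRepresentations.absGaloisGroupAdjoinRootsOfUnity K₀ p).subtype) ∧ Literature.NumberTheory.GaloisRepresentations.Subgroup.IsEnormous ((Literature.NumberTheory.GaloisRepresentations.absGaloisGroupAdjoinRootsOfUnity K₀ p).map τ) ∧ ∃ g₀ : Field.absoluteGaloisGroup K₀, g₀ ∉ Literature.NumberTheory.GaloisRepresentations.absGaloisGroupAdjoinRootsOfUnity K₀ p ∧ ∃ c : Literature.NumberTheory.GaloisRepresentations.padicAlgClResidueField p, ((τ g₀ : Matrix.GeneralLinearGroup (Fin n) (Literature.NumberTheory.GaloisRepresentations.padicAlgClResidueField p)) : Matrix (Fin n) (Fin n) (Literature.NumberTheory.GaloisRepresentations.padicAlgClResidueField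 p)) = c • (1 : Matrix (Fin n) (Fin n) (Literature.NumberTheory.GaloisRepresentations.padicAlgClResidueField p))) π₀ β ∧ ∃ (p : ℕ) (_ : Fact p.Prime) (ι' : PadicAlgCl p ≃+* ℂ) (s : Literature.NumberTheory.GaloisRepresentations.FramedGaloisRep K₀ (PadicAlgCl p) 2), (∀ᶠ v : IsDedekindDomain.HeightOneSpectrum (NumberField.RingOfIntegers K₀) in Filter.cofinite, SatakeFrobCompatibleAt ι' β.1 s v) ∧ ∃ (F : Type) (_ : Field F) (_ : NumberField F) (_ : Algebra F K₀), NumberField.IsTotallyReal F ∧ Module.finrank F K₀ = 2 ∧ ∃ (sF : Literature.NumberTheory.GaloisRepresentations.FramedGaloisRep F (PadicAlgCl p) 2) (χ : Field.absoluteGaloisGroup K₀ →* PadicAlgCl p), sF.toGaloisRep.IsIrreducible ∧ Summit.Langlands.Langlands.Theorems.MonodromyDichotomySymmetricPowerAnchor.IsPinnedGeometric F p sF ∧ ∀ g : Field.absoluteGaloisGroup K₀, Literature.NumberTheory.GaloisRepresentations.FramedRep.charpoly s g = (Literature.NumberTheory.GaloisRepresentations.FramedRep.charpoly (sF.restrictField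 K₀) g).scaleRoots (χ g)) → (∃ (hcpt₂ : Literature.NumberTheory.Automorphic.isCompact_glFiniteIntegralLevel 2 K₀) (S : Finset (IsDedekindDomain.HeightOneSpectrum (NumberField.RingOfIntegers K₀))) (π₀ β : Literature.NumberTheory.Automorphic.CuspidalAutomorphicRepData 2 K₀ hcpt₂), (∀ᶠ v : IsDedekindDomain.HeightOneSpectrum (NumberField.RingOfIntegers K₀) in Filter.cofinite, SatakeFrobCompatibleAt ι π₀.1 σ₀ v) ∧ Relation.ReflTransGen (fun π π' : Literature.NumberTheory.Automorphic.CuspidalAutomorphicRepData 2 K₀ hcpt₂ => (∀ v : IsDedekindDomain.HeightOneSpectrum (NumberField.RingOfIntegers K₀), v ∉ S → π.1.IsUnramifiedAt v ∧ π'.1.IsUnramifiedAt v) ∧ ∃ (p : ℕ) (_ : Fact p.Prime) (ι' : PadicAlgCl p ≃+* ℂ) (T : Literature.NumberTheory.Automorphic.InfinityType K₀ 2) (s s' : Literature.NumberTheory.GaloisRepresentations.FramedGaloisRep K₀ (PadicAlgCl p) 2) (R R' : Literature.NumberTheory.GaloisRepresentations.FramedGaloisRep K₀ (PadicAlgCl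 p) n) (τ : Field.absoluteGaloisGroup K₀ →* Matrix.GeneralLinearGroup (Fin n) (Literature.NumberTheory.GaloisRepresentations.padicAlgClResidueField p)), n ^ 2 < p ∧ Algebra.IsUnramifiedIn (NumberField.RingOfIntegers K₀) (Ideal.span {(p : ℤ)}) ∧ (∀ v : IsDedekindDomain.HeightOneSpectrum (NumberField.RingOfIntegers K₀), ((p : ℕ) : NumberField.RingOfIntegers K₀) ∈ v.asIdeal → v ∉ S) ∧ (∀ v : IsDedekindDomain.HeightOneSpectrum (NumberField.RingOfIntegers K₀), ((p : ℕ) : NumberField.RingOfIntegers K₀) ∈ v.asIdeal → π.1.IsUnramifiedAt v ∧ π'.1.IsUnramifiedAt v) ∧ π.1.HasInfinityType T ∧ π'.1.HasInfinityType T ∧ T.IsLAlgebraic ∧ T.IsRegular ∧ (∀ e : K₀ →+* ℂ, ∀ w₁ ∈ T e, ∀ w₂ ∈ T e, ((n : ℝ) - 1) * (‖w₁.a - w₂.a‖ + ‖w₁.b - w₂.b‖ + 2) + 2 * n < (p : ℝ)) ∧ (∀ᶠ v : IsDedekindDomain.HeightOneSpectrum (NumberField.RingOfIntegers K₀) in Filter.cofinite,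 SatakeFrobCompatibleAt ι' π.1 s v) ∧ (∀ᶠ v : IsDedekindDomain.HeightOneSpectrum (NumberField.RingOfIntegers K₀) in Filter.cofinite, SatakeFrobCompatibleAt ι' π'.1 s' v) ∧ Summit.Langlands.Langlands.Theorems.MonodromyDichotomySymmetricPowerAnchor.IsSymShadow K₀ p n R s ∧ Summit.Langlands.Langlands.Theorems.MonodromyDichotomySymmetricPowerAnchor.IsSymShadow K₀ p n R' s' ∧ R.IsResidualRepOf (RingHom.id _) τ ∧ R'.IsResidualRepOf (RingHom.id _) τ ∧ Literature.NumberTheory.GaloisRepresentations.IsAbsIrreducible τ ∧ Literature.NumberTheory.GaloisRepresentations.IsDecomposedGeneric τ ∧ Literature.NumberTheory.GaloisRepresentations.IsAbsIrreducible (τ.comp (Literature.NumberTheory.GaloisRepresentations.absGaloisGroupAdjoinRootsOfUnity K₀ p).subtype) ∧ Literature.NumberTheory.GaloisRepresentations.Subgroup.IsEnormous ((Literature.NumberTheory.GaloisRepresentations.absGaloisGroupAdjoinRootsOfUnity K₀ p).map τ) ∧ ∃ g₀ : Field.absoluteGaloisGroup K₀, g₀ ∉ Literature.NumberTheory.GaloisRepresentations.absGaloisGroupAdjoinRootsOfUnity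 K₀ p ∧ ∃ c : Literature.NumberTheory.GaloisRepresentations.padicAlgClResidueField p, ((τ g₀ : Matrix.GeneralLinearGroup (Fin n) (Literature.NumberTheory.GaloisRepresentations.padicAlgClResidueField p)) : Matrix (Fin n) (Fin n) (Literature.NumberTheory.GaloisRepresentations.padicAlgClResidueField p)) = c • (1 : Matrix (Fin n) (Fin n) (Literature.NumberTheory.GaloisRepresentations.padicAlgClResidueField p))) π₀ β ∧ ∃ (p : ℕ) (_ : Fact p.Prime) (ι' : PadicAlgCl p ≃+* ℂ) (s : Literature.NumberTheory.GaloisRepresentations.FramedGaloisRep K₀ (PadicAlgCl p) 2) (τ₂ : Field.absoluteGaloisGroup K₀ →* Matrix.GeneralLinearGroup (Fin 2) (Literature.NumberTheory.GaloisRepresentations.padicAlgClResidueField p)) (M : Type) (_ : Field M) (_ : NumberField M) (_ : Algebra K₀ M), n ^ 2 < p ∧ (∀ᶠ v : IsDedekindDomain.HeightOneSpectrum (NumberField.RingOfIntegers K₀) in Filter.cofinite, SatakeFrobCompatibleAt ι' β.1 s v) ∧ s.IsResidualRepOf (RingHom.id _) τ₂ ∧ 0 < Module.finrank K₀ M ∧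 Module.finrank K₀ M ≤ 2 ∧ NumberField.IsCMField M ∧ ¬ Literature.NumberTheory.GaloisRepresentations.IsAbsIrreducible (τ₂.comp (Literature.NumberTheory.GaloisRepresentations.absGaloisRestrictMonoidHom K₀ M))) → ∃ P : Literature.NumberTheory.Automorphic.CuspidalAutomorphicRepData n K₀ hcpt, P.1.IsLAlgebraic ∧ ∀ᶠ v : IsDedekindDomain.HeightOneSpectrum (NumberField.RingOfIntegers K₀) in Filter.cofinite, ∃ a b : ℂ, σ₀.IsUnramifiedAt v ∧ σ₀.HasFrobCharpolyAt v (Literature.NumberTheory.Automorphic.arithFrobPolyOfSatake ι v.residueCard 1 ({a, b} : Multiset ℂ)) ∧ P.1.HasSatakeParamAt v (Literature.NumberTheory.Automorphic.symmPowerParams (n - 1) a b)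

-- earlier BaseChangeSeededSymPower (stmt-Langlands-26674, replaced 2026-08-30T22:35:05Z -> stmt-Langlands-26840): retired by None — ∀ (K₀ : Type) [Field K₀] [NumberField K₀] (n : ℕ) (hcpt : Literature.NumberTheory.Automorphic.isCompact_glFiniteIntegralLevel n K₀), 6 ≤ n → Summit.Langlands.Langlands.Theorems.MonodromyDichotomySymmetricPowerAnchor.RankIH n → NumberField.IsCMField K₀ → ∀ (ℓ : ℕ) [Fact 
/-- item stmt-Langlands-26840 · crux · rank 4 · open · by planner
why it might fail: Print modulo typing, but the edge must carry EVERY hypothesis of ACC+ 6.1.1: if «π unramified above p» does not give crystallinity + the HT formula for the avatar in the tree's conventions (AHTW 2026 as a fact), or FL-smallness is mis-normalised, A as typed is unprovable until the edge is restated.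
sources: NewtonThorne2022hilbert = arXiv:2212.03595, Ann. of Math. 203 (2026), Thm 1 (Sym^m for non-CM regular algebraic Hilbert pi) [corpus:paper:arxiv-2212.03595 p3], ArthurClozel1989 = Ann. of Math. Stud. 120 (cyclic base change and descent; tree: Literature.NumberTheory.Automorphic.baseChange_cyclic_cuspidal, exists_baseChange_cyclic), ACCGHLNSTT2023 = arXiv:1812.09999, Ann. of Math. 197 (2023), Thm 6.1.1 (non-polarised FL automorphy lifting over CM) [corpus:paper:arxiv-1812.09999 p64; p3]; tree fact Literature.NumberTheory.Automorphic.ACCGHLNSTT2023.automorphyLifting_crystalline_weightZero, ACampoHevesiThorneWhitmore2026 = arXiv:2607.11763 (local-global compatibility at p for automorphic Galois representations over CM fields: crystalline at unramified v | p, Hodge-Tate weights) [corpus:paper:arxiv-2607.11763 p5-6], tree: Summit.Langlands.Langlands.Theses.SymmetricPowerAnchorSplit (rev 1) — CMSymmetricPowerAutomorphy stmt-Langlands-28219, closes; Theorems.MonodromyDichotomySymmetricPowerAnchor (cm_iff, cm_of_langlands, IsPinnedGeometric, IsLieIrreducible, RankIH, IsSymShadow, HasCohomologicalPartner), BoxerCalegariGeeNewtonThorne2023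 = arXiv:2309.15880, Thm C (Sym^m of GL_2 over CM: POTENTIAL automorphy only; p4 «actually modular seems out of reach») [corpus:paper:arxiv-2309.15880 p4]
[crux] A — BASE-CHANGE-SEEDED Sym^{n−1} (WEAKER than SPF/FC: kernel `a_of_spf`). Same σ₀; IF the
partner π₀ is joined by a finite chain of ADMISSIBLE Sym^{n−1}-congruences at a common LEVEL SET S
(each edge = hypotheses (1)–(5) of ACC+ Thm 6.1.1 for Sym^{n−1} of the two avatars at a prime p > n²
whose places lie outside S, both forms unramified outside S — so every 6.1.1-witness along the chain
is unramified above the edge prime, rev 1) to a BASE-CHANGE form β (an avatar of β is χ ⊗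
σ_F|Γ_{K₀}, σ_F irreducible pinned-geometric over a totally real F ⊂ K₀ of index 2), THEN σ₀ is
Sym^{n−1}-weakly automorphic. PRINT modulo typing: IH(2) over F ⇒ π_F, regular algebraic (BC(π_F) ≃
β ⊗ χ′ cohomological, archimedean base change) and non-CM (σ₀ Lie-irreducible); Newton–Thorne 2022
Thm 1 ⇒ Sym^{n−1} π_F; Arthur–Clozel quadratic base change + cuspidality from Lie-irreducibility ⇒
Sym^{n−1} β; ACC+ 6.1.1 along each edge (crystalline/HT at p by AHTW 2026; identifications by
Chebotarev–Brauer–Nesbitt–JS) ⇒ Sym^{n−1} π₀; Satake bookkeeping ⇒ conclusion. ATTACKABLE-NOW (typer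
chain T-A, est. L/XL); first rung = chain length 0 (birth stub `stub_bcSeedAtPartner`). -/
@[route_item "route-Langlands-SeedReachSplit", crux]
def BaseChangeSeededSymPower : Prop :=
  ∀ (K₀ : Type) [Field K₀] [NumberField K₀] (n : ℕ) (hcpt : Literature.NumberTheory.Automorphic.isCompact_glFiniteIntegralLevel n K₀), 6 ≤ n → Summit.Langlands.Langlands.Theorems.MonodromyDichotomySymmetricPowerAnchor.RankIH n → NumberField.IsCMField K₀ → ∀ (ℓ : ℕ) [Fact ℓ.Prime] (ι : PadicAlgCl ℓ ≃+* ℂ) (σ₀ : Literature.NumberTheory.GaloisRepresentations.FramedGaloisRep K₀ (PadicAlgCl ℓ) 2), σ₀.toGaloisRep.IsIrreducible → Summit.Langlands.Langlands.Theorems.MonodromyDichotomySymmetricPowerAnchor.IsPinnedGeometric K₀ ℓ σ₀ → Summit.Langlands.Langlands.Theorems.MonodromyDichotomySymmetricPowerAnchor.IsLieIrreducible K₀ ℓ σ₀ → Summit.Langlands.Langlands.Theorems.MonodromyDichotomySymmetricPowerAnchor.HasCohomologicalPartner K₀ ℓ ι σ₀ → (∃ (hcpt₂ : Literature.NumberTheory.Automorphic.isCompact_glFiniteIntegralLevel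 2 K₀) (S : Finset (IsDedekindDomain.HeightOneSpectrum (NumberField.RingOfIntegers K₀))) (π₀ β : Literature.NumberTheory.Automorphic.CuspidalAutomorphicRepData 2 K₀ hcpt₂), (∀ᶠ v : IsDedekindDomain.HeightOneSpectrum (NumberField.RingOfIntegers K₀) in Filter.cofinite, SatakeFrobCompatibleAt ι π₀.1 σ₀ v) ∧ Relation.ReflTransGen (fun π π' : Literature.NumberTheory.Automorphic.CuspidalAutomorphicRepData 2 K₀ hcpt₂ => (∀ v : IsDedekindDomain.HeightOneSpectrum (NumberField.RingOfIntegers K₀), v ∉ S → π.1.IsUnramifiedAt v ∧ π'.1.IsUnramifiedAt v) ∧ ∃ (p : ℕ) (_ : Fact p.Prime) (ι' : PadicAlgCl p ≃+* ℂ) (T : Literature.NumberTheory.Automorphic.InfinityType K₀ 2) (s s' : Literature.NumberTheory.GaloisRepresentations.FramedGaloisRep K₀ (PadicAlgCl p) 2) (R R' : Literature.NumberTheory.GaloisRepresentations.FramedGaloisRep K₀ (PadicAlgCl p) n) (τ : Field.absoluteGaloisGroup K₀ →* Matrix.GeneralLinearGroup (Fin n) (Literature.NumberTheory.GaloisRepresentations.padicAlgClResidueField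 p)), n ^ 2 < p ∧ Algebra.IsUnramifiedIn (NumberField.RingOfIntegers K₀) (Ideal.span {(p : ℤ)}) ∧ (∀ v : IsDedekindDomain.HeightOneSpectrum (NumberField.RingOfIntegers K₀), ((p : ℕ) : NumberField.RingOfIntegers K₀) ∈ v.asIdeal → v ∉ S) ∧ (∀ v : IsDedekindDomain.HeightOneSpectrum (NumberField.RingOfIntegers K₀), ((p : ℕ) : NumberField.RingOfIntegers K₀) ∈ v.asIdeal → π.1.IsUnramifiedAt v ∧ π'.1.IsUnramifiedAt v) ∧ π.1.HasInfinityType T ∧ π'.1.HasInfinityType T ∧ T.IsLAlgebraic ∧ T.IsRegular ∧ (∀ e : K₀ →+* ℂ, ∀ w₁ ∈ T e, ∀ w₂ ∈ T e, ((n : ℝ) - 1) * (‖w₁.a - w₂.a‖ + ‖w₁.b - w₂.b‖ + 2) + 2 * n < (p : ℝ)) ∧ (∀ᶠ v : IsDedekindDomain.HeightOneSpectrum (NumberField.RingOfIntegers K₀) in Filter.cofinite, SatakeFrobCompatibleAt ι' π.1 s v) ∧ (∀ᶠ v : IsDedekindDomain.HeightOneSpectrum (NumberField.RingOfIntegers K₀)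 in Filter.cofinite, SatakeFrobCompatibleAt ι' π'.1 s' v) ∧ Summit.Langlands.Langlands.Theorems.MonodromyDichotomySymmetricPowerAnchor.IsSymShadow K₀ p n R s ∧ Summit.Langlands.Langlands.Theorems.MonodromyDichotomySymmetricPowerAnchor.IsSymShadow K₀ p n R' s' ∧ R.IsResidualRepOf (RingHom.id _) τ ∧ R'.IsResidualRepOf (RingHom.id _) τ ∧ Literature.NumberTheory.GaloisRepresentations.IsAbsIrreducible τ ∧ Literature.NumberTheory.GaloisRepresentations.IsDecomposedGeneric τ ∧ Literature.NumberTheory.GaloisRepresentations.IsAbsIrreducible (τ.comp (Literature.NumberTheory.GaloisRepresentations.absGaloisGroupAdjoinRootsOfUnity K₀ p).subtype) ∧ Literature.NumberTheory.GaloisRepresentations.Subgroup.IsEnormous ((Literature.NumberTheory.GaloisRepresentations.absGaloisGroupAdjoinRootsOfUnity K₀ p).map τ) ∧ ∃ g₀ : Field.absoluteGaloisGroup K₀, g₀ ∉ Literature.NumberTheory.GaloisRepresentations.absGaloisGroupAdjoinRootsOfUnity K₀ p ∧ ∃ c : Literature.NumberTheory.GaloisRepresentations.padicAlgClResidueField p,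 ((τ g₀ : Matrix.GeneralLinearGroup (Fin n) (Literature.NumberTheory.GaloisRepresentations.padicAlgClResidueField p)) : Matrix (Fin n) (Fin n) (Literature.NumberTheory.GaloisRepresentations.padicAlgClResidueField p)) = c • (1 : Matrix (Fin n) (Fin n) (Literature.NumberTheory.GaloisRepresentations.padicAlgClResidueField p))) π₀ β ∧ ∃ (p : ℕ) (_ : Fact p.Prime) (ι' : PadicAlgCl p ≃+* ℂ) (s : Literature.NumberTheory.GaloisRepresentations.FramedGaloisRep K₀ (PadicAlgCl p) 2), (∀ᶠ v : IsDedekindDomain.HeightOneSpectrum (NumberField.RingOfIntegers K₀) in Filter.cofinite, SatakeFrobCompatibleAt ι' β.1 s v) ∧ ∃ (F : Type) (_ : Field F) (_ : NumberField F) (_ : Algebra F K₀), NumberField.IsTotallyReal F ∧ Module.finrank F K₀ = 2 ∧ ∃ (sF : Literature.NumberTheory.GaloisRepresentations.FramedGaloisRep F (PadicAlgCl p) 2) (χ : Field.absoluteGaloisGroup K₀ →* PadicAlgCl p), sF.toGaloisRep.IsIrreducible ∧ Summit.Langlands.Langlands.Theorems.MonodromyDichotomySymmetricPowerAnchor.IsPinnedGeometric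 F p sF ∧ ∀ g : Field.absoluteGaloisGroup K₀, Literature.NumberTheory.GaloisRepresentations.FramedRep.charpoly s g = (Literature.NumberTheory.GaloisRepresentations.FramedRep.charpoly (sF.restrictField K₀) g).scaleRoots (χ g)) → ∃ P : Literature.NumberTheory.Automorphic.CuspidalAutomorphicRepData n K₀ hcpt, P.1.IsLAlgebraic ∧ ∀ᶠ v : IsDedekindDomain.HeightOneSpectrum (NumberField.RingOfIntegers K₀) in Filter.cofinite, ∃ a b : ℂ, σ₀.IsUnramifiedAt v ∧ σ₀.HasFrobCharpolyAt v (Literature.NumberTheory.Automorphic.arithFrobPolyOfSatake ι v.residueCard 1 ({a, b} : Multiset ℂ)) ∧ P.1.HasSatakeParamAt v (Literature.NumberTheory.Automorphic.symmPowerParams (n - 1) a b)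

/-- item stmt-Langlands-26675 · support · rank 9 · open · by planner
sources: tree: Summit.Langlands.Langlands.Theses.SymmetricPowerAnchorSplit (rev 1) — CMSymmetricPowerAutomorphy stmt-Langlands-28219, closes; Theorems.MonodromyDichotomySymmetricPowerAnchor (cm_iff, cm_of_langlands, IsPinnedGeometric, IsLieIrreducible, RankIH, IsSymShadow, HasCohomologicalPartner)
[support] FRAME″ — SPF → Langlands, where SPF = Sym^{n−1} functoriality at a CM cohomological
partner in Satake clothing (the node's EQUIV of FC 28219: `fc_of_spf` proved outright). CERTIFIED
from the host route: `SeedReach.frame_of_host : AnchorlessSymTypeAutomorphy →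
LowSymmetricPowerAutomorphy → HilbertSymmetricPowerAutomorphy → CliffordSolvableDescent →
SolvableAnchorTransport → AvatarSymmetricPowerFrame → SeedReachFrame` (=
SymmetricPowerAnchorSplit.closes with its FC binder fed by fc_of_spf); Langlands-implied trivially
(`frame_of_langlands`). Glue, not a crux: it closes when the host's other items close. -/
@[route_item "route-Langlands-SeedReachSplit", crux]
def SeedReachFrame : Prop :=
  (∀ (K₀ : Type) [Field K₀] [NumberField K₀] (n : ℕ) (hcpt : Literature.NumberTheory.Automorphic.isCompact_glFiniteIntegralLevel n K₀), 6 ≤ n → Summit.Langlands.Langlands.Theorems.MonodromyDichotomySymmetricPowerAnchor.RankIH n → NumberField.IsCMField K₀ → ∀ (ℓ : ℕ) [Fact ℓ.Prime] (ι : PadicAlgCl ℓ ≃+* ℂ) (σ₀ : Literature.NumberTheory.GaloisRepresentations.FramedGaloisRep K₀ (PadicAlgCl ℓ) 2), σ₀.toGaloisRep.IsIrreducible → Summit.Langlands.Langlands.Theorems.MonodromyDichotomySymmetricPowerAnchor.IsPinnedGeometric K₀ ℓ σ₀ → Summit.Langlands.Langlands.Theorems.MonodromyDichotomySymmetricPowerAnchor.IsLieIrreducible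 K₀ ℓ σ₀ → Summit.Langlands.Langlands.Theorems.MonodromyDichotomySymmetricPowerAnchor.HasCohomologicalPartner K₀ ℓ ι σ₀ → ∃ P : Literature.NumberTheory.Automorphic.CuspidalAutomorphicRepData n K₀ hcpt, P.1.IsLAlgebraic ∧ ∀ᶠ v : IsDedekindDomain.HeightOneSpectrum (NumberField.RingOfIntegers K₀) in Filter.cofinite, ∃ a b : ℂ, σ₀.IsUnramifiedAt v ∧ σ₀.HasFrobCharpolyAt v (Literature.NumberTheory.Automorphic.arithFrobPolyOfSatake ι v.residueCard 1 ({a, b} : Multiset ℂ)) ∧ P.1.HasSatakeParamAt v (Literature.NumberTheory.Automorphic.symmPowerParams (n - 1) a b)) → _root_.Langlands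

/-- item stmt-Langlands-26676 · assembly · rank 1 · closed · proved by Summit.Langlands.Langlands.Theorems.seedReachSplit_assembly_proof (prover) · by planner
sources: tree: Summit.Langlands.Langlands.Theses.SymmetricPowerAnchorSplit (rev 1) — CMSymmetricPowerAutomorphy stmt-Langlands-28219, closes; Theorems.MonodromyDichotomySymmetricPowerAnchor (cm_iff, cm_of_langlands, IsPinnedGeometric, IsLieIrreducible, RankIH, IsSymShadow, HasCohomologicalPartner)
[assembly] the curried form of `closes`: pure logic — FRAME″ reduces Langlands to SPF; SPF from the
three pieces by two excluded middles on the reach of the partner's admissible congruence class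
(BC-reachable ↦ A; else Eisenstein/theta-reachable ↦ B; else ↦ C) — node kernel
`SeedReach.spf_of_pieces`. -/
@[route_item "route-Langlands-SeedReachSplit"]
def Assembly : Prop :=
  BaseChangeSeededSymPower → ThetaSeededSymPower → SeedIsolatedSymPower → SeedReachFrame → _root_.Langlands

-- `Assembly` holds: proved by `Summit.Langlands.Langlands.Theorems.seedReachSplit_assembly_proof` (its module imports this route file, so no `_holds` link can be stated here).

/-! D-0027 §2.1 — DECIDING THEOREM (planner-authored via `route open/edit --closes-file`; by planner-decomp-langlands-writer-1-g5-0 2026-08-30T22:35:05Z):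
its hypotheses are this route's items and its conclusion the sub-problem Statement (glue_lint), and it elaborates with this file. -/

/- D-0027 §2.1 deciding theorem for the child route SeedReachSplit (decomp-langlands lens-3 gen 15; refines
   SymmetricPowerAnchorSplit:CMSymmetricPowerAutomorphy stmt-Langlands-28219).  Pure logic over the route's OWN items: FRAME″ reduces `Langlands`
   to SPF (Sym^(n-1) functoriality at a CM cohomological partner, Satake clothing); SPF is cut EXACTLY by two excluded middles on the reach of the
   partner's admissible congruence class (BC-reachable ↦ A; else theta-reachable ↦ B; else ↦ C).  `Classical.em _` is unified from the pieces'
   negated hypotheses, never spelled out.  = node kernel `SeedReach.closes` = `hF (spf_of_pieces hA hB hC)`. -/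
@[closes "route-Langlands-SeedReachSplit"] theorem closes (hA : BaseChangeSeededSymPower) (hB : ThetaSeededSymPower) (hC : SeedIsolatedSymPower) (hF : SeedReachFrame) :
    _root_.Langlands := by
  refine hF ?_
  intro K₀ _ _ n hcpt h6 hIH hCM ℓ _ ι σ₀ h1 h2 h3 h4
  refine (Classical.em _).elim (fun hbc => hA K₀ n hcpt h6 hIH hCM ℓ ι σ₀ h1 h2 h3 h4 hbc) (fun hbc => ?_)
  exact (Classical.em _).elim (fun hth => hB K₀ n hcpt h6 hIH hCM ℓ ι σ₀ h1 h2 h3 h4 hbc hth) (fun hth => hC K₀ n hcpt h6 hIH hCM ℓ ι σ₀ h1 h2 h3 h4 hbc hth)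

end Summit.Langlands.Langlands.Theses.SeedReachSplit
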